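import Summits.PneNP.PneNP.Theses.OneSlice
import Summits.PneNP.PneNP.Theorems.OneSliceAssembly
import Summits.PneNP.PneNP.Theorems.OneSliceSliceMonotonization
import Summits.PneNP.PneNP.Theorems.OneSliceCliqueCircuitsOfNPSubsetPPoly
import Summits.PneNP.PneNP.Theorems.ConstantBand.Negative.LoadBearing
import Summits.PneNP.PneNP.Theorems.SingleThreshold.Negative.LoadBearing

/-!
# Strategy census for crux `SliceTarget` (stmt-PneNP-2832, route PneNP/OneSlice) — the typed attempts

Companion to `Cruxes/SliceTarget/STRATEGY-CENSUS.md` (crux-strategist `cstrat-stmt-PneNP-2832`, 2026-08-16).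
Everything here is `sorry`-free and imports only LANDED modules. The crux is
X = `Summit.PneNP.PneNP.Theses.OneSlice.SliceTarget` = `∀ c, ∃ k ≥ 3, ∃ δ > 0, SliceLB c k δ` (`sliceTarget_iff`, `Iff.rfl`).

What is CHECKED here (section = heading of the census):

* §W (feeds Strengthen / Decomposition / Negation). The worst-case core of X. `SliceTargetExact` (`δ = 0`),
  `SliceTargetMin` (exact, on the ONE slice `j = m_k(n)`, infinitely often) and the chain
  `SliceTarget → SliceTargetExact → SliceTargetMin → PneNP` — the last arrow is NEW as a kernel-checked fact
  (`pneNP_of_sliceTargetMin`; the disprover's §5 recorded it in prose): the route's assembly consumes only the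
  minimal worst-case form, so every weakening of X down to `SliceTargetMin` is still summit-strength, and a
  refutation of X by an AVERAGE-CASE algorithm (kill criterion K4 / the judge's key risk) would NOT break the route
  (`closes` re-certifies from `SliceTargetMin`).
* §S Strengthen. `SliceTargetTail` (the `k`-monotone tail any induction on `k` needs), `SliceTargetLinear`
  (explicit exponent `k/a`, Rossman's conjectured shape), `SliceIndist` (o(1)-advantage form = the hosted card's C⁺ modulo its
  own lemmas); `sliceTarget_of_tail`, `tail_of_linear` (so Linear ⇒ Tail ⇒ X). No arrow back: each is strictly more to prove.
* §D Decomposition. Two typed splits with their glue PROVED: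
  `sliceTarget_of_selfCorrect_exact : SelfCorrect → SliceTargetExact → SliceTarget` (worst-case core + average-to-worst
  self-correction on the slice) and `sliceTarget_of_smoothing_singleThreshold : SliceSmoothing → SingleThreshold → SliceTarget`
  (the route's own rung #2 + a slice-to-`G(n,p)` smoothing for monotone circuits). In both the summit-strength piece is
  identified in the census: `SliceTargetExact ⟹ PneNP` (§W), and `SliceSmoothing` is `SingleThreshold → X` in costume.
* §T Transfer. `SwapInsensitive` — the engine of the solved AC⁰ sibling (Rossman 2008: small circuits do not notice a planted
  `k`-clique), transplanted to the slice with the recentred swap (remove `C(k,2)` present edges, plant `K_A`) so that both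
  ends stay on the slice. Typed only to pin the break point: it is false for polynomial-size `{∧₂,∨₂}`-circuits on one slice
  (pseudo-complements realise parity there), see the census.

Nothing in this file is a line skeleton: no `stub_*`, no theorem concludes the crux from open obligations (by design — the
census verdict is `no-strategy-short-of-summit`).
-/

set_option linter.dupNamespace false

namespace Summit.PneNP.PneNP.Cruxes.SliceTarget.StrategyCensus

open Literature.Computability.Complexity Filter Finset Classical
open Summit.PneNP.PneNP.Theses.OneSlice (SliceTarget SingleThreshold SliceMonotonization
  CliqueCircuitsOfNPSubsetPPoly)
open Summit.PneNP.PneNP.Theorems (oneSlice_NP_subset_PPoly_of_not_pneNP oneSlice_threshold_pos_lt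
  oneSlice_size_bound sliceMonotonization_proof cliqueCircuitsOfNPSubsetPPoly_proof)
open Summit.PneNP.PneNP.Theorems.ConstantBand.Negative (Edge thr Central central_thr slice errSet)
open Summit.PneNP.PneNP.Theorems.SingleThreshold.Negative (pc err LowerBoundAt singleThreshold_iff_lib)

/-! ## §0 Read-back (same as the disprover's `Disproof.sliceTarget_iff`) -/

/-- The crux at fixed parameters `(c, k, δ)`. [folklore] -/
def SliceLB (c k : ℕ) (δ : ℝ) : Prop :=
  ∀ᶠ n : ℕ in atTop, ∀ j : ℕ, Central k n j → ∀ C : Circuit (Edge n), C.IsOver monotoneBasis →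
    (#(errSet n k j C) : ℝ) ≤ δ * #(slice n j) → n ^ c < C.size

/-- Read-back: X is `∀ c, ∃ k ≥ 3, ∃ δ > 0, SliceLB c k δ`, definitionally. [folklore] -/
theorem sliceTarget_iff : SliceTarget ↔ ∀ c : ℕ, ∃ k : ℕ, 3 ≤ k ∧ ∃ δ : ℝ, 0 < δ ∧ SliceLB c k δ :=
  Iff.rfl

/-- Smaller exponent = weaker claim (for `n ≥ 1`). [folklore] -/
theorem SliceLB.anti_exp {c c' k : ℕ} {δ : ℝ} (h : c' ≤ c) (H : SliceLB c k δ) : SliceLB c' k δ := by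
  filter_upwards [H, eventually_ge_atTop 1] with n hn h1 j hj C hC herr
  exact lt_of_le_of_lt (Nat.pow_le_pow_right h1 h) (hn j hj C hC herr)

/-! ## §W The worst-case core of X and the certificate that it already closes the route -/

/-- The exact-on-the-slice inner clause (`δ = 0`). [folklore] -/
def SliceLBExact (c k : ℕ) : Prop :=
  ∀ᶠ n : ℕ in atTop, ∀ j : ℕ, Central k n j → ∀ C : Circuit (Edge n), C.IsOver monotoneBasis →
    (∀ x : Edge n → Bool, edgeCount x = j → C.eval x = cliqueFn n k x) → n ^ c < C.size

/-- W = X with `δ = 0`: the central-slice functions of `CLIQUE_{k(c)}` have `{∧₂,∨₂}`-circuit complexity `> n^c`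
eventually (= general complexity up to Berkowitz's additive `O(N log² N)`). [folklore] -/
def SliceTargetExact : Prop := ∀ c : ℕ, ∃ k : ℕ, 3 ≤ k ∧ SliceLBExact c k

/-- W_min: exact, on the ONE slice `j = m_k(n)`, infinitely often in `n`. [folklore] -/
def SliceTargetMin : Prop :=
  ∀ c : ℕ, ∃ k : ℕ, 3 ≤ k ∧ ∃ᶠ n : ℕ in atTop, ∀ C : Circuit (Edge n), C.IsOver monotoneBasis →
    (∀ x : Edge n → Bool, edgeCount x = thr k n → C.eval x = cliqueFn n k x) → n ^ c < C.size

/-- An exact circuit has an empty error set, so `δ`-accuracy bounds contain the exact bound. [folklore] -/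
theorem sliceLBExact_of_sliceLB {c k : ℕ} {δ : ℝ} (hδ : 0 ≤ δ) (H : SliceLB c k δ) : SliceLBExact c k := by
  filter_upwards [H] with n hn j hj C hC hex
  have hempty : errSet n k j C = ∅ := filter_eq_empty_iff.2 fun x _ hx => hx.2 (hex x hx.1)
  refine hn j hj C hC (le_trans (le_of_eq ?_) (mul_nonneg hδ (Nat.cast_nonneg _)))
  rw [hempty, card_empty, Nat.cast_zero]

/-- X ⟹ W. [folklore] -/
theorem sliceTargetExact_of_sliceTarget (h : SliceTarget) : SliceTargetExact := fun c => by
  obtain ⟨k, hk, δ, hδ, H⟩ := sliceTarget_iff.1 h c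
  exact ⟨k, hk, sliceLBExact_of_sliceLB hδ.le H⟩

/-- W ⟹ W_min. [folklore] -/
theorem sliceTargetMin_of_sliceTargetExact (h : SliceTargetExact) : SliceTargetMin := fun c => by
  obtain ⟨k, hk, H⟩ := h c
  exact ⟨k, hk, (H.mono fun n hn C hC hex => hn (thr k n) (central_thr k n) C hC hex).frequently⟩

/-- **W_min already closes the route** (NEW as a checked fact; the disprover's §5 in prose): the assembly's proof
(`oneSlice_assembly_proof`, item 10382) consumes X only at `j = m_k(n)`, error `0`, one large `n`; rerun here from
`SliceTargetMin` with the PROVED supports `sliceMonotonization_proof` (item 2836) and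
`cliqueCircuitsOfNPSubsetPPoly_proof` (item 2837). So X over-delivers along three axes (average case, `∀ᶠ n`,
uniformity in `j`) and every statement between X and W_min is summit-strength. [folklore] -/
theorem pneNP_of_sliceTargetMin (hMin : SliceTargetMin) : _root_.PneNP := by
  by_contra hPNP
  obtain ⟨c₁, hc₁⟩ := cliqueCircuitsOfNPSubsetPPoly_proof (oneSlice_NP_subset_PPoly_of_not_pneNP hPNP)
  obtain ⟨c₀, hc₀⟩ := sliceMonotonization_proof
  obtain ⟨k, hk, hfr⟩ := hMin (c₀ + c₁ + 1)
  obtain ⟨n, hT, hC, ⟨hMpos, hMlt⟩, hsize⟩ :=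
    (hfr.and_eventually ((hc₁ k).and ((oneSlice_threshold_pos_lt hk).and (oneSlice_size_bound c₀ c₁)))).exists
  obtain ⟨C, hCB2, hCcomp, hCsize⟩ := hC
  obtain ⟨C', hC'mono, hC'size, hC'eval⟩ := hc₀ n (thr k n) C hCB2 hMpos hMlt
  have hlt : n ^ (c₀ + c₁ + 1) < C'.size :=
    hT C' hC'mono fun x hx => (hC'eval x hx).trans (hCcomp x)
  have habs : n ^ (c₀ + c₁ + 1) < n ^ (c₀ + c₁ + 1) :=
    calc n ^ (c₀ + c₁ + 1) < C'.size := hlt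
      _ ≤ c₀ * (C.size + n ^ c₀) := hC'size
      _ ≤ c₀ * (n ^ c₁ + n ^ c₀) := Nat.mul_le_mul_left _ (Nat.add_le_add_right hCsize _)
      _ ≤ n ^ (c₀ + c₁ + 1) := hsize
  exact lt_irrefl _ habs

/-- Hence W closes the route too. [folklore] -/
theorem pneNP_of_sliceTargetExact (h : SliceTargetExact) : _root_.PneNP :=
  pneNP_of_sliceTargetMin (sliceTargetMin_of_sliceTargetExact h)

/-- And X closes it through W (the same term as the route's `closes`, factored through the worst case). [folklore] -/
theorem pneNP_of_sliceTarget (h : SliceTarget) : _root_.PneNP :=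
  pneNP_of_sliceTargetExact (sliceTargetExact_of_sliceTarget h)

/-! ## §S Strengthenings (typed; each implies X by a line of logic; none admits an engine X lacks — see the census) -/

/-- S⁺₁ (tail form): hardness for ALL `k ≥ k₀(c)`, not just one `k` — the shape any induction on `k` would need.
[folklore] -/
def SliceTargetTail : Prop :=
  ∀ c : ℕ, ∃ k₀ : ℕ, ∀ k : ℕ, k₀ ≤ k → ∃ δ : ℝ, 0 < δ ∧ SliceLB c k δ

/-- Tail ⟹ X. [folklore] -/
theorem sliceTarget_of_tail (h : SliceTargetTail) : SliceTarget := by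
  rw [sliceTarget_iff]
  intro c
  obtain ⟨k₀, hk₀⟩ := h c
  obtain ⟨δ, hδ, H⟩ := hk₀ (max k₀ 3) (le_max_left _ _)
  exact ⟨max k₀ 3, le_max_right _ _, δ, hδ, H⟩

/-- S⁺₂ (explicit exponent, Rossman's conjectured shape `n^{Ω(k)}`): exponent `⌊k/a⌋` for all large `k`.
[folklore] -/
def SliceTargetLinear : Prop :=
  ∃ a : ℕ, 0 < a ∧ ∃ k₀ : ℕ, ∀ k : ℕ, k₀ ≤ k → ∃ δ : ℝ, 0 < δ ∧ SliceLB (k / a) k δ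

/-- Linear ⟹ Tail (so Linear ⟹ X). [folklore] -/
theorem tail_of_linear (h : SliceTargetLinear) : SliceTargetTail := by
  obtain ⟨a, ha, k₀, hk₀⟩ := h
  intro c
  refine ⟨max k₀ (a * c), fun k hk => ?_⟩
  obtain ⟨δ, hδ, H⟩ := hk₀ k ((le_max_left _ _).trans hk)
  refine ⟨δ, hδ, H.anti_exp ?_⟩
  apply (Nat.le_div_iff_mul_le ha).2
  calc c * a = a * c := mul_comm _ _
    _ ≤ max k₀ (a * c) := le_max_right _ _
    _ ≤ k := hk

/-- The yes-part of a slice (graphs with exactly `j` edges that contain a `k`-clique). [folklore] -/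
noncomputable def yesSet (n k j : ℕ) : Finset (Edge n → Bool) :=
  (slice n j).filter fun x => cliqueFn n k x = true

/-- The no-part of a slice. [folklore] -/
noncomputable def noSet (n k j : ℕ) : Finset (Edge n → Bool) :=
  (slice n j).filter fun x => cliqueFn n k x = false

/-- Number of accepted inputs of `C` inside `S`. [folklore] -/
noncomputable def accOn {n : ℕ} (S : Finset (Edge n → Bool)) (C : Circuit (Edge n)) : ℕ :=
  #(S.filter fun x => C.eval x = true)

/-- S⁺₃ (indistinguishability form, = `SliceIndist` of TRIAGE-r1-1 l.14, = the hosted card's C⁺ modulo its own two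
lemmas): small monotone circuits have conditional acceptance rates on the yes- and no-parts of every central slice that
differ by at most `γ`, for EVERY `γ > 0` (cross-multiplied to avoid divisions). [folklore] -/
def SliceIndist : Prop :=
  ∀ c : ℕ, ∃ k : ℕ, 3 ≤ k ∧ ∀ γ : ℝ, 0 < γ → ∀ᶠ n : ℕ in atTop, ∀ j : ℕ, Central k n j →
    ∀ C : Circuit (Edge n), C.IsOver monotoneBasis → C.size ≤ n ^ c →
      |(accOn (yesSet n k j) C : ℝ) * #(noSet n k j) - (accOn (noSet n k j) C : ℝ) * #(yesSet n k j)|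
        ≤ γ * #(yesSet n k j) * #(noSet n k j)

/-! ## §D Decompositions (typed splits with PROVED glue; the census says which piece keeps the summit) -/

/-- D1, piece A2W (average-to-worst SELF-CORRECTION on the slice, non-uniform, same `k`, same slice, polynomial
overhead `c ↦ c'`, `δ(c,k)` as small as wanted): a small `δ`-accurate `{∧₂,∨₂}`-circuit on a central slice yields a
small circuit EXACT on that slice. [folklore] -/
def SelfCorrect : Prop :=
  ∀ c : ℕ, ∃ c' : ℕ, ∀ k : ℕ, 3 ≤ k → ∃ δ : ℝ, 0 < δ ∧ ∀ᶠ n : ℕ in atTop, ∀ j : ℕ, Central k n j →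
    (∃ C : Circuit (Edge n), C.IsOver monotoneBasis ∧ C.size ≤ n ^ c ∧
        (#(errSet n k j C) : ℝ) ≤ δ * #(slice n j)) →
    ∃ C' : Circuit (Edge n), C'.IsOver monotoneBasis ∧ C'.size ≤ n ^ c' ∧
        ∀ x : Edge n → Bool, edgeCount x = j → C'.eval x = cliqueFn n k x

/-- **D1 glue**: self-correction + the worst-case core give X. [folklore] -/
theorem sliceTarget_of_selfCorrect_exact (hA : SelfCorrect) (hW : SliceTargetExact) : SliceTarget := by
  rw [sliceTarget_iff]
  intro c
  obtain ⟨c', hc'⟩ := hA c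
  obtain ⟨k, hk, hWk⟩ := hW c'
  obtain ⟨δ, hδ, hAk⟩ := hc' k hk
  refine ⟨k, hk, δ, hδ, ?_⟩
  filter_upwards [hWk, hAk] with n hWn hAn j hj C hC herr
  by_contra hle
  obtain ⟨C', hC', hsize', hex⟩ := hAn j hj ⟨C, hC, not_lt.1 hle, herr⟩
  exact absurd (hWn j hj C' hC' hex) (not_lt.2 hsize')

/-- D2, piece SliceSmoothing (slice-to-`G(n,p_c)` smoothing INSIDE the monotone world, polynomial overhead `c ↦ c'`
independent of `k`): a small slice-accurate monotone circuit yields a small monotone circuit accurate on `G(n, p_c)`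
(error `err n k C' ≤ δ'`, the SingleThreshold lane's vocabulary). [folklore] -/
def SliceSmoothing : Prop :=
  ∀ c : ℕ, ∃ c' : ℕ, ∀ k : ℕ, 3 ≤ k → ∀ δ' : ℝ, 0 < δ' → ∃ δ : ℝ, 0 < δ ∧ ∀ᶠ n : ℕ in atTop, ∀ j : ℕ,
    Central k n j →
    (∃ C : Circuit (Edge n), C.IsOver monotoneBasis ∧ C.size ≤ n ^ c ∧
        (#(errSet n k j C) : ℝ) ≤ δ * #(slice n j)) →
    ∃ C' : Circuit (Edge n), C'.IsOver monotoneBasis ∧ C'.size ≤ n ^ c' ∧ err n k C' ≤ δ'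

/-- **D2 glue**: smoothing + the route's rung #2 `SingleThreshold` give X. [folklore] -/
theorem sliceTarget_of_smoothing_singleThreshold (hS : SliceSmoothing) (hT : SingleThreshold) :
    SliceTarget := by
  rw [sliceTarget_iff]
  intro c
  obtain ⟨c', hc'⟩ := hS c
  obtain ⟨k, hk, δ', hδ', hTk⟩ := singleThreshold_iff_lib.1 hT c'
  obtain ⟨δ, hδ, hSk⟩ := hc' k hk δ' hδ'
  refine ⟨k, hk, δ, hδ, ?_⟩
  filter_upwards [hTk, hSk] with n hTn hSn j hj C hC herr
  by_contra hle
  obtain ⟨C', hC', hsize', herr'⟩ := hSn j hj ⟨C, hC, not_lt.1 hle, herr⟩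
  exact absurd (hTn C' hC' herr') (not_lt.2 hsize')

/-! ## §T Transfer: the AC⁰ sibling's engine, transplanted to the slice (typed to pin the break point) -/

/-- The recentred planted swap on a slice: switch OFF the edges of `R` (in applications `R ⊆ supp x`,
`#R = C(k,2)`), then plant `K_A`; for `x` on slice `j` and `K_A` edge-disjoint from `x ∖ R` the result is again on
slice `j` (incomparable test pair — the only kind one slice admits). [folklore] -/
noncomputable def swapPlant {n : ℕ} (R : Finset (Edge n)) (A : Finset (Fin n)) (x : Edge n → Bool) : Edge n → Bool :=
  plantClique A fun e => x e && !decide (e ∈ R)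

/-- T⁺ `SwapInsensitive c k η`: eventually, on every central slice, every `{∧₂,∨₂}`-circuit of size `≤ n^c` changes
its value under the recentred planted swap on at most an `η`-fraction of the triples `(x, A, R)` (`x` on the slice, `A` a
`k`-set, `R` a `C(k,2)`-subset of the present edges). This is Rossman 2008's "small constant-depth circuits do not notice a
planted clique" (his Thm 1.1, `plantFlipProb`) moved to the slice. It would give X against `CLIQUE_k`'s own
swap-sensitivity (`≈ 1 - O(λ)`), but it is FALSE for polynomial size at unbounded depth: on one slice pseudo-complements
compute literals, so parity of a fixed half of the edge slots is a polynomial-size MONOTONE slice circuit with swap-flip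
probability `→ 1/2` (census §Transfer (a)). [folklore] -/
def SwapInsensitive (c k : ℕ) (η : ℝ) : Prop :=
  ∀ᶠ n : ℕ in atTop, ∀ j : ℕ, Central k n j → ∀ C : Circuit (Edge n), C.IsOver monotoneBasis →
    C.size ≤ n ^ c →
      (∑ x ∈ slice n j, ∑ A ∈ powersetCard k (univ : Finset (Fin n)),
          ∑ R ∈ powersetCard (k.choose 2) (univ.filter fun e : Edge n => x e = true),
            (if C.eval (swapPlant R A x) = C.eval x then (0 : ℝ) else 1))
        ≤ η * ((#(slice n j) : ℝ) * (n.choose k) * (j.choose (k.choose 2)))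

end Summit.PneNP.PneNP.Cruxes.SliceTarget.StrategyCensus
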